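import Literature.RepresentationTheory.MoeglinVignerasWaldspurger1987.RankOneThetaLift
import Literature.RepresentationTheory.TwistedCoinvariantsFreeOrbit
import Literature.RepresentationTheory.HeisenbergGroup.SchrodingerIsotropicEigenfunctional
import Literature.NumberTheory.Automorphic.QuadraticCoordinatesIsotropicLine
import Literature.NumberTheory.Automorphic.UnitaryGroupNonsplitTorus
import Literature.NumberTheory.Automorphic.LocalPiSchwartzBruhatFourier
import Literature.NumberTheory.Automorphic.Liu2021.LemD1AsPrintedIndexedNonVacuityAtPlace
import HarnessLib

/-!
# Proof of MVW 1987, Chap. 3 §IV.2 Lemme (stable range) in the rank-one case: the theta lift of every character of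
# `U(1) = E_v¹` to `U(V)(F_v)`, `V` isotropic, is non-zero — `mvw_IV2_rankOne_nonvanishing_of_isotropic_holds`

Topic `RepresentationTheory/MoeglinVignerasWaldspurger1987`; namespace
`Literature.RepresentationTheory.MoeglinVignerasWaldspurger1987`.  KERNEL ONLY: this file DISCHARGES the named fact
`mvw_IV2_rankOne_nonvanishing_of_isotropic` of `RankOneThetaLift.lean` ([MoeglinVignerasWaldspurger1987, Chap. 3 §IV.2
Lemme, p. 76]: «Tout `π ∈ Irr(H_m)~` est quotient de `ω_{m,n}`», rank-one case `H = U(W)`, `dim W = 1`, at a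
non-split place, read at the tree's honest local Weil representation) by a proof over Mathlib and the tree's
Heisenberg/Schrödinger layer; no new definition, no `sorry`.

THE PROOF (MVW's mixed-model argument «évaluation le long d'une orbite», transported to the Schrödinger model on
`𝒮(F_vᴺ)` so that no mixed model is needed as an object).  Fix the data of the fact: `ω_s = toRep ∘ s` on
`S = 𝒮(F_vᴺ)`, the centre `Z = U(J₁)(F_v) = E_v¹` acting through `M = ω_s ∘ localCenter`, a unitary continuous `χ`.
1. `Z` is compact and totally disconnected (non-split place), `M` is smooth, `ker χ` is open
   (`UnitaryGroupNonsplitTorus`).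
2. `V = (E_vᴺ, J ⊗ 1)` isotropic and `E_v` a field ⇒ an isotropic `x ∈ E_vᴺ` whose real and imaginary parts
   `a, b ∈ F_vᴺ` (polarisation `Res V = F_vᴺ·1 ⊕ F_vᴺ·δ`) are linearly independent, a symmetric `S_x` with
   `𝕋 · im(e x) = S_x · re(e x)` for all `e ∈ E_v` and `a'` with `a' · re(e x) = re e`
   (`QuadraticCoordinatesIsotropicLine`): the `E_v`-LINE `L = {reIm(e x)}` of `𝕎_v` is isotropic and lies in the
   Lagrangian graph of `S_x`.
3. On `L` the Heisenberg group is abelian through `w ↦ (w, ½B(w,w))`, and EVERY implementer of `g ∈ Sp(𝕎_v)`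
   transports `ρ(w, ½B(w,w))` to `ρ(gw, ½B(gw,gw))` WITHOUT scalar (`SchrodingerIsotropicEigenfunctional` §1); since
   `ι(z)` acts on `𝕎_v = reIm(E_vᴺ)` by `reIm ∘ (ζ ·) ∘ reIm⁻¹` (`localToSymplectic_reIm`, `localCenter_theta`), the
   unknown operators `M_z = s(z)` satisfy `M_z ρ_L(e) M_z⁻¹ = ρ_L(ζ_z e)` EXACTLY, whatever the splitting `s`.
4. The Gaussian functional `μ(Φ) = ∫ ψ_v(½ uᵀS_x u - a'·u) Φ(u) du` is a `θ`-eigenfunctional of `ρ_L`,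
   `θ(e) = ψ_v(re e)` (`integral_gauss_mul_schrodingerSB`), non-zero on a box indicator.
5. The orbit of `θ` under `E_v¹` is free away from `1`, uniformly: off the open stabiliser `U₀` of the test vector,
   `|ζ_z - 1|_w` is bounded below (`exists_forall_sub_one_notMem_primePowBall`), so `c = (ζ_z - 1)⁻¹ t₀`
   (`ψ_v(t₀) ≠ 1`) lies in a fixed ball `C` of `E_v` and `θ(ζ_z c)/θ(c) = ψ_v(t₀) ≠ 1`; a small ball `C₀ ⊆ ker θ` is
   `E_v¹`-stable (`|ζ_z|_w = 1`) and `C/C₀` is finite.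
6. The free-orbit occurrence criterion `TwistedCoinv.nontrivial_coinv_of_free_orbit` (`TwistedCoinvariantsFreeOrbit`)
   gives a non-zero `χ`-eigenvector, which survives in the `χ`-coinvariants.

HC_CM / Hodge-type statements are not mentioned and nothing about them is proved here.

## References
* [MoeglinVignerasWaldspurger1987] C. Mœglin, M.-F. Vignéras, J.-L. Waldspurger, *Correspondances de Howe sur un corps
  p-adique*, LNM 1291 (1987), Chap. 2 II.1, Chap. 3 §IV.2 Lemme + proof (p. 76), Remarque b).
* [Liu2021] Y. Liu, Camb. J. Math. 9 (2021), App. D Lemma D.1 (1), p. 125–126 (the same non-vanishing via persistence).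
-/

set_option autoImplicit false

noncomputable section

open NumberField IsDedekindDomain MeasureTheory
open scoped Matrix NNReal Topology
open Literature.RepresentationTheory.HeisenbergGroup
open Literature.NumberTheory.GelbartRogawski1991.UnitaryDualPair.LocalSplitting (iota iota_def LocalMp localSchrodinger localPairing localGram)
open Literature.NumberTheory.Automorphic
open Literature.NumberTheory.Automorphic.UnitaryGroup
open Literature.NumberTheory.Automorphic.Liu2021
open Literature.NumberTheory.GaloisRepresentations.IsNonarchimedeanLocalField

namespace Literature.RepresentationTheory.MoeglinVignerasWaldspurger1987

section Helpers

variable {F : Type} [Field F] [NumberField F] (E : Type) [Field E] [NumberField E] [Algebra F E]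
  [Algebra.IsQuadraticExtension F E] (v : HeightOneSpectrum (𝓞 F)) (c : E ≃ₐ[F] E) (N : ℕ) {δ : E} (hcδ : c δ = -δ)
  (hδ : δ ≠ 0) (hN : 2 ≤ N) {J : Matrix (Fin N) (Fin N) E} (hJh : (J.map c)ᵀ = J) (hJdet : J.det ≠ 0)

/-- the isotropic `E_v`-line in general position and its Lagrangian graph, for the standing data of the place `v`:
from a non-zero isotropic vector of `(E_vᴺ, J ⊗ 1)` (`E_v` a field, `det T` a unit) we get an isotropic `x` with
independent real/imaginary parts, a symmetric `S_x` with `𝕋 · im(e x) = S_x · re(e x)` and `a'` with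
`a' · re(e x) = re e` for all `e ∈ E_v`. [cite: MoeglinVignerasWaldspurger1987, Chap. 3 §IV.2 (the line `X'`)] -/
private theorem exists_line {d : F} (hd : δ * δ = algebraMap F E d) (T : Matrix (Fin N) (Fin N) F) (hT : T.IsSymm)
    (hTd : IsUnit T.det) (hJ : J = T.map (algebraMap F E)) (hE : IsField (LocalRing E v))
    (hiso : LemD1.IsIsotropic (LemD1OfPlace.standingData E v c N J hcδ hδ hN hJh hJdet)) :
    ∃ (x : Fin N → LocalRing E v) (Sx : Matrix (Fin N) (Fin N) (v.adicCompletion F)) (a' : Fin N → v.adicCompletion F),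
      Sx.IsSymm ∧
      (∀ e : LocalRing E v, T.map (algebraMap F (v.adicCompletion F)) *ᵥ
          (QuadraticCoordinates.reIm (quadraticLocalEquiv E v c hcδ hδ).toLinearEquiv.toAddEquiv (Fin N) (e • x)).2 =
        Sx *ᵥ (QuadraticCoordinates.reIm (quadraticLocalEquiv E v c hcδ hδ).toLinearEquiv.toAddEquiv (Fin N) (e • x)).1) ∧
      (∀ e : LocalRing E v,
        a' ⬝ᵥ (QuadraticCoordinates.reIm (quadraticLocalEquiv E v c hcδ hδ).toLinearEquiv.toAddEquiv (Fin N) (e • x)).1 =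
          QuadraticCoordinates.re (quadraticLocalEquiv E v c hcδ hδ).toLinearEquiv.toAddEquiv e) := by
  have hq : IsQuadraticCoordinates (toLocalRing E v) (quadraticLocalEquiv E v c hcδ hδ).toLinearEquiv.toAddEquiv
      (algebraMap E (LocalRing E v) δ) (d : v.adicCompletion F) := isQuadraticCoordinates_local E v c hcδ hδ hd
  -- the conjugation of the standing data is `c ⊗ 1`
  have hσφ : ∀ a, (LemD1OfPlace.standingData E v c N J hcδ hδ hN hJh hJdet).σ (toLocalRing E v a) = toLocalRing E v a :=
    fun a => conjLocal_toLocalRing c v a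
  have hσδ : (LemD1OfPlace.standingData E v c N J hcδ hδ hN hJh hJdet).σ (algebraMap E (LocalRing E v) δ) =
      -algebraMap E (LocalRing E v) δ := by
    change conjLocal E c v (algebraMap E (LocalRing E v) δ) = _
    rw [conjLocal_algebraMap, hcδ, map_neg]
  have hTv_symm : (T.map (algebraMap F (v.adicCompletion F))).IsSymm := hT.map _
  have hTv_det : IsUnit (T.map (algebraMap F (v.adicCompletion F))).det :=
    UnitaryGroup.isUnit_det_map (algebraMap F (v.adicCompletion F)) hTd
  obtain ⟨x₀, hx₀0, hx₀⟩ := hiso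
  have hx₀' : hermForm (LemD1OfPlace.standingData E v c N J hcδ hδ hN hJh hJdet).σ
      ((T.map (algebraMap F (v.adicCompletion F))).map (toLocalRing E v)) x₀ x₀ = 0 := by
    have h0 : hermForm (LemD1OfPlace.standingData E v c N J hcδ hδ hN hJh hJdet).σ
        (LemD1OfPlace.standingData E v c N J hcδ hδ hN hJh hJdet).gram x₀ x₀ = 0 := hx₀
    rwa [LemD1OfPlace.standingData_gram, localForm_eq_map E N v T hJ] at h0
  -- `d` is not a square in `F_v`: otherwise `(δ - κ)(δ + κ) = 0` in the field `E_v`, but `im δ = 1`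
  have hdns : ∀ κ : v.adicCompletion F, κ * κ ≠ (d : v.adicCompletion F) := by
    intro κ hκ
    letI := hE.toField
    have hprod : (algebraMap E (LocalRing E v) δ - toLocalRing E v κ) *
        (algebraMap E (LocalRing E v) δ + toLocalRing E v κ) = 0 := by
      have h1 : algebraMap E (LocalRing E v) δ * algebraMap E (LocalRing E v) δ =
          toLocalRing E v (d : v.adicCompletion F) := hq.mul_self
      have h2 : toLocalRing E v κ * toLocalRing E v κ = toLocalRing E v (d : v.adicCompletion F) := by
        rw [← map_mul, hκ]
      linear_combination h1 - h2
    have him := hq.im_delta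
    rcases mul_eq_zero.1 hprod with h | h
    · have h' := congrArg (QuadraticCoordinates.im (quadraticLocalEquiv E v c hcδ hδ).toLinearEquiv.toAddEquiv)
        (sub_eq_zero.1 h)
      rw [him, hq.im_map] at h'
      exact one_ne_zero h'
    · have h' := congrArg (QuadraticCoordinates.im (quadraticLocalEquiv E v c hcδ hδ).toLinearEquiv.toAddEquiv)
        (eq_neg_of_add_eq_zero_left h)
      rw [him, map_neg, hq.im_map, neg_zero] at h'
      exact one_ne_zero h'
  obtain ⟨x, hxiso, hli⟩ :=
    hq.exists_isotropic_linearIndependent (Fin N) hTv_symm hTv_det hdns hσφ hσδ hx₀0 hx₀'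
  obtain ⟨Sx, a', hSx, hgraph, hdual⟩ := hq.exists_isSymm_graph_and_dual (Fin N) hdns hσφ hσδ hxiso hli
  exact ⟨x, Sx, a', hSx, hgraph, hdual⟩

/-- **the centre acts on `𝕎_v = reIm(E_vᴺ)` by scalars**: `ι(z)(reIm y) = reIm(ζ y)` for `z = θ(ζ)`, `ζ ∈ E_v¹`
(`localCenter_theta`, `localToSymplectic_reIm`). [cite: MoeglinVignerasWaldspurger1987, Ch. 1 I.17] -/
private theorem iota_localCenter_theta_reIm {d : F} (hd : δ * δ = algebraMap F E d) (T : Matrix (Fin N) (Fin N) F)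
    (hT : T.IsSymm) (hJ : J = T.map (algebraMap F E)) (J₁ : Matrix (Fin 1) (Fin 1) E) (hJ₁ : J₁ 0 0 ≠ 0)
    (ζ : (LemD1OfPlace.standingData E v c N J hcδ hδ hN hJh hJdet).normOne) (y : Fin N → LocalRing E v) :
    (iota F E c N hcδ hδ hd T hT hJ v (localCenter E c N J J₁ hJ₁ v
        (LemD1OfPlace.theta E v c N J hcδ hδ hN hJh hJdet J₁ ζ))).1
      (QuadraticCoordinates.reIm (quadraticLocalEquiv E v c hcδ hδ).toLinearEquiv.toAddEquiv (Fin N) y) =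
      QuadraticCoordinates.reIm (quadraticLocalEquiv E v c hcδ hδ).toLinearEquiv.toAddEquiv (Fin N)
        ((((ζ : (LocalRing E v)ˣ) : LocalRing E v)) • y) := by
  rw [iota_def, LemD1OfPlace.localCenter_theta E v c N J hcδ hδ hN hJh hJdet J₁ hJ₁ ζ]
  change (localToSymplectic E c N v hcδ hδ hd hT hJ (localPiEquiv E c N J v
    (LemD1OfPlace.uEquiv E v c N J hcδ hδ hN hJh hJdet
      ((LemD1OfPlace.standingData E v c N J hcδ hδ hN hJh hJdet).scalar ζ)))).1 _ = _
  rw [localToSymplectic_reIm]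
  congr 1
  rw [coe_localPiEquiv_apply, LemD1OfPlace.coe_uEquiv_apply, ContinuousMulEquiv.symm_apply_apply,
    Literature.RepresentationTheory.Liu2021.OscillatorStandingData.coe_scalar]
  ext i
  simp [Matrix.scalar_apply, Matrix.mulVec_diagonal]

/-- the entry of `θ(ζ)` at `w'` is `ζ_{w'}`. [cite: Mok2014, §1 Notation p. 5] -/
private theorem entry_theta (J₁ : Matrix (Fin 1) (Fin 1) E)
    (ζ : (LemD1OfPlace.standingData E v c N J hcδ hδ hN hJh hJdet).normOne) (w' : PlacesOver E v) :
    ((((LemD1OfPlace.theta E v c N J hcδ hδ hN hJh hJdet J₁ ζ : localPi E c 1 J₁ v) : LocalGLPi E 1 v) w' :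
      GL (Fin 1) (w'.1.adicCompletion E)) : Matrix (Fin 1) (Fin 1) (w'.1.adicCompletion E)) 0 0 =
      ((ζ : (LocalRing E v)ˣ) : LocalRing E v) w' := by
  rw [LemD1OfPlace.coe_theta_apply, Matrix.diagonal_apply_eq]

end Helpers

-- one long assembly proof (seven tree interfaces instantiated in a 30-binder context); about 2× the default budget.
set_option maxHeartbeats 400000 in
/-- **[MVW 1987, Chap. 3 §IV.2 Lemme] in the rank-one case, PROVED**: at a non-split finite place, for every smooth
splitting `s` of `U(J)(F_v)` into the local metaplectic group over `ι`, every hermitian line `J₁` and every continuous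
unitary character `χ` of `U(J₁)(F_v) = E_v¹`, if the hermitian space `(E_vᴺ, J ⊗ 1)` (`N ≥ 2`) is isotropic then the
`χ`-coinvariants of `ω_s` under the centre are NON-ZERO — the theta lift of `χ` to `U(V)` does not vanish in the stable
range.  Discharges the named fact `mvw_IV2_rankOne_nonvanishing_of_isotropic`.
[cite: MoeglinVignerasWaldspurger1987, Chap. 3 §IV.2 Lemme (p. 76)] -/
theorem mvw_IV2_rankOne_nonvanishing_of_isotropic_holds : mvw_IV2_rankOne_nonvanishing_of_isotropic := by
  intro F _ _ E _ _ _ _ c N δ hcδ hδ d hd T hT hTd J hJ v hE hN hJh hJdet hiso s hs hsm J₁ hJ₁ χ hχu hχc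
  classical
  /- §0 the non-split place: compact torus, smooth action, open kernel -/
  have hc1 : c ≠ 1 := by
    rintro rfl
    exact hδ (self_eq_neg.1 (by simpa only [AlgEquiv.one_apply] using hcδ))
  obtain ⟨w⟩ := (inferInstance : Nonempty (PlacesOver E v))
  have hw : c • w.1 = w.1 := by
    by_contra hw
    exact LemD1IndexedNonVacuityAtPlace.not_isField_localRing_of_split E v c w hw hE
  haveI hsub : Subsingleton (PlacesOver E v) := PlacesOver.subsingleton_of_smul_eq c hc1 w hw
  haveI : CompactSpace (localPi E c 1 J₁ v) := compactSpace_localPi_one_of_smul_eq c J₁ hc1 hJ₁ w hw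
  let M : Representation ℂ (localPi E c 1 J₁ v) (SchwartzBruhat (Fin N → v.adicCompletion F)) :=
    ((MpPsi.toRep (localSchrodinger F N T v)).comp s).comp (localCenter E c N J J₁ hJ₁ v)
  have hMs : M.IsSmooth := fun Φ =>
    show IsOpen ((localCenter E c N J J₁ hJ₁ v) ⁻¹'
      ((Representation.stabilizerSubgroup ((MpPsi.toRep (localSchrodinger F N T v)).comp s) Φ :
        Subgroup (localPi E c N J v)) : Set (localPi E c N J v))) from
      (hsm Φ).preimage (continuous_localCenter E c N J J₁ hJ₁ v)
  have hχo : IsOpen (χ.ker : Set (localPi E c 1 J₁ v)) := isOpen_ker_of_smul_eq c J₁ hc1 hJ₁ w hw χ hχc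
  /- §1 the line: `x`, the graph `S_x`, the dual vector `a'` -/
  obtain ⟨RI, hRI⟩ : ∃ RI : (Fin N → LocalRing E v) ≃+ ((Fin N → v.adicCompletion F) × (Fin N → v.adicCompletion F)),
      RI = QuadraticCoordinates.reIm (quadraticLocalEquiv E v c hcδ hδ).toLinearEquiv.toAddEquiv (Fin N) := ⟨_, rfl⟩
  obtain ⟨x, Sx, a', hSx, hgraph, hdual⟩ := exists_line E v c N hcδ hδ hN hJh hJdet hd T hT hTd hJ hE hiso
  simp only [← hRI] at hgraph hdual
  have hiota : ∀ (ζ : (LemD1OfPlace.standingData E v c N J hcδ hδ hN hJh hJdet).normOne) (y : Fin N → LocalRing E v),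
      (iota F E c N hcδ hδ hd T hT hJ v (localCenter E c N J J₁ hJ₁ v
        (LemD1OfPlace.theta E v c N J hcδ hδ hN hJh hJdet J₁ ζ))).1 (RI y) =
        RI ((((ζ : (LocalRing E v)ˣ) : LocalRing E v)) • y) := by
    intro ζ y
    rw [hRI]
    exact iota_localCenter_theta_reIm E v c N hcδ hδ hN hJh hJdet hd T hT hJ J₁ hJ₁ ζ y
  /- §2 Haar measure on `F_vᴺ`, the phase `ψ_v(q u - l u)` and the Gaussian functional -/
  letI : MeasurableSpace (Fin N → v.adicCompletion F) := borel _
  haveI : BorelSpace (Fin N → v.adicCompletion F) := ⟨rfl⟩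
  have hψlc : IsLocallyConstant (⇑(adeleAddCharAt F v) : v.adicCompletion F → Circle) :=
    isLocallyConstant_of_isContinuousNontrivial (isContinuousNontrivial_adeleAddCharAt F v)
  have hβc : ∀ y : Fin N → v.adicCompletion F, Continuous fun u : Fin N → v.adicCompletion F => localPairing F N T v u y :=
    fun y => by
      simp only [Matrix.toLinearMap₂'_apply']
      exact continuous_id.dotProduct continuous_const
  obtain ⟨qf, hqf⟩ : ∃ qf : (Fin N → v.adicCompletion F) → v.adicCompletion F,
      ∀ u, qf u = ⅟(2 : v.adicCompletion F) * (u ⬝ᵥ Sx *ᵥ u) := ⟨_, fun u => rfl⟩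
  obtain ⟨lf, hlf⟩ : ∃ lf : (Fin N → v.adicCompletion F) →+ v.adicCompletion F, ∀ u, lf u = a' ⬝ᵥ u :=
    ⟨AddMonoidHom.mk' (fun u => a' ⬝ᵥ u) (dotProduct_add a'), fun u => rfl⟩
  have hphase_cont : Continuous fun u : Fin N → v.adicCompletion F => qf u - lf u := by
    simp only [hqf, hlf]
    exact (continuous_const.mul (continuous_id.dotProduct (continuous_const.matrix_mulVec continuous_id))).sub
      (continuous_const.dotProduct continuous_id)
  have hcph_lc : IsLocallyConstant fun u : Fin N → v.adicCompletion F =>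
      ((adeleAddCharAt F v (qf u - lf u) : Circle) : ℂ) :=
    (hψlc.comp_continuous hphase_cont).comp ((↑) : Circle → ℂ)
  obtain ⟨μℓ, hμℓ⟩ := exists_linearMap_eq_integral_gauss_mul (Measure.addHaar)
    (fun u : Fin N → v.adicCompletion F => ((adeleAddCharAt F v (qf u - lf u) : Circle) : ℂ)) hcph_lc.continuous
  /- §3 the operators of the line, the eigencharacter `θ = ψ_v ∘ re`, and the eigenfunctional identity -/
  obtain ⟨ρL, hρL⟩ : ∃ ρL : LocalRing E v →
      SchwartzBruhat (Fin N → v.adicCompletion F) →ₗ[ℂ] SchwartzBruhat (Fin N → v.adicCompletion F),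
      ∀ e, ρL e = localSchrodinger F N T v
        ⟨RI (e • x), ⅟(2 : v.adicCompletion F) * polar (localPairing F N T v) (RI (e • x)) (RI (e • x))⟩ :=
    ⟨_, fun e => rfl⟩
  obtain ⟨θ, hθa⟩ : ∃ θ : AddChar (LocalRing E v) ℂ, ∀ e, θ e =
      ((adeleAddCharAt F v (QuadraticCoordinates.re (quadraticLocalEquiv E v c hcδ hδ).toLinearEquiv.toAddEquiv e) :
        Circle) : ℂ) :=
    ⟨Circle.coeHom.compAddChar ((adeleAddCharAt F v).compAddMonoidHom
      (QuadraticCoordinates.re (quadraticLocalEquiv E v c hcδ hδ).toLinearEquiv.toAddEquiv)), fun e => rfl⟩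
  have hqcond : ∀ (e : LocalRing E v) (u : Fin N → v.adicCompletion F),
      qf (u + (RI (e • x)).1) = qf u + qf (RI (e • x)).1 + localPairing F N T v u (RI (e • x)).2 := by
    intro e u
    have h2 : (⅟(2 : v.adicCompletion F)) * 2 = 1 := invOf_mul_self _
    have hsym : (RI (e • x)).1 ⬝ᵥ Sx *ᵥ u = u ⬝ᵥ Sx *ᵥ (RI (e • x)).1 := by
      rw [Matrix.dotProduct_mulVec, ← Matrix.vecMul_transpose, hSx, dotProduct_comm]
    rw [Matrix.toLinearMap₂'_apply', hgraph e]
    simp only [hqf, Matrix.mulVec_add, dotProduct_add, add_dotProduct, hsym]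
    linear_combination (u ⬝ᵥ Sx *ᵥ (RI (e • x)).1) * h2
  have hρeq : localSchrodinger F N T v = schrodingerSB (localPairing F N T v) (adeleAddCharAt F v) hψlc hβc := rfl
  have hμ : ∀ (e : LocalRing E v) (Φ : SchwartzBruhat (Fin N → v.adicCompletion F)), μℓ (ρL e Φ) = θ e * μℓ Φ := by
    intro e Φ
    have helt : (⟨RI (e • x), ⅟(2 : v.adicCompletion F) * polar (localPairing F N T v) (RI (e • x)) (RI (e • x))⟩ :
        Heisenberg (polar (localPairing F N T v))) = ⟨((RI (e • x)).1, (RI (e • x)).2), qf (RI (e • x)).1⟩ :=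
      Heisenberg.ext rfl (by
        show ⅟(2 : v.adicCompletion F) * polar (localPairing F N T v) (RI (e • x)) (RI (e • x)) = qf (RI (e • x)).1
        rw [polar_apply, Matrix.toLinearMap₂'_apply', hgraph e, hqf])
    rw [hρL, hμℓ, hμℓ, hθa, hρeq, helt,
      integral_gauss_mul_schrodingerSB (localPairing F N T v) (adeleAddCharAt F v) Measure.addHaar hψlc hβc qf lf
        (hqcond e) Φ, hlf, hdual e]
  /- §4 the test vector `φ₀ = 1_{(𝔭^{n₂})^N}` with phase `≡ 1` on the box -/
  have hph1 : {u : Fin N → v.adicCompletion F | ((adeleAddCharAt F v (qf u - lf u) : Circle) : ℂ) = 1} ∈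
      𝓝 (0 : Fin N → v.adicCompletion F) := by
    refine (hcph_lc.isOpen_fiber 1).mem_nhds ?_
    simp only [Set.mem_setOf_eq, hqf, hlf, Matrix.mulVec_zero, dotProduct_zero, mul_zero, sub_zero,
      AddChar.map_zero_eq_one, Circle.coe_one]
  obtain ⟨n₂, hn₂⟩ := exists_piPrimePowBall_subset_of_mem_nhds_zero hph1
  obtain ⟨φ₀, hφ₀⟩ : ∃ φ₀ : SchwartzBruhat (Fin N → v.adicCompletion F),
      (φ₀ : (Fin N → v.adicCompletion F) → ℂ) = (piPrimePowBall (v.adicCompletion F) (Fin N) (n₂ : ℤ)).indicator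
        fun _ => (1 : ℂ) :=
    ⟨⟨_, indicator_piPrimePowBall_mem_schwartzBruhat _ _⟩, rfl⟩
  have hφ₀μ : μℓ φ₀ ≠ 0 := by
    rw [hμℓ, hφ₀, integral_gauss_mul_indicator Measure.addHaar _ (measurableSet_piPrimePowBall (n₂ : ℤ))
      fun u hu => hn₂ hu]
    exact_mod_cast (measureReal_piPrimePowBall_pos (Measure.addHaar (G := Fin N → v.adicCompletion F)) (n₂ : ℤ)).ne'
  /- §5 the balls of `E_v`; `C₀ ⊆ ker θ` -/
  obtain ⟨ball, hball⟩ : ∃ ball : ℤ → AddSubgroup (LocalRing E v), ∀ (n : ℤ) (e : LocalRing E v),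
      e ∈ ball n ↔ ∀ w' : PlacesOver E v, e w' ∈ primePowBall (w'.1.adicCompletion E) n :=
    ⟨fun n =>
      { carrier := {e | ∀ w' : PlacesOver E v, e w' ∈ primePowBall (w'.1.adicCompletion E) n}
        add_mem' := fun {a b} ha hb w' => by rw [Pi.add_apply]; exact add_mem_primePowBall (ha w') (hb w')
        zero_mem' := fun w' => zero_mem_primePowBall n
        neg_mem' := fun {a} ha w' => by rw [Pi.neg_apply]; exact neg_mem_primePowBall (ha w') },
      fun n e => Iff.rfl⟩
  have hball_set : ∀ n : ℤ, (ball n : Set (LocalRing E v)) =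
      Set.univ.pi fun w' : PlacesOver E v => primePowBall (w'.1.adicCompletion E) n := by
    intro n; ext e; simp [hball]
  have hball_cpt : ∀ n : ℤ, IsCompact (ball n : Set (LocalRing E v)) := fun n => by
    rw [hball_set]; exact isCompact_univ_pi fun w' => isCompact_primePowBall n
  have hball_open : ∀ n : ℤ, IsOpen (ball n : Set (LocalRing E v)) := fun n => by
    rw [hball_set]; exact isOpen_set_pi Set.finite_univ fun w' _ => isOpen_primePowBall n
  have hθ1 : {e : LocalRing E v | θ e = 1} ∈ 𝓝 (0 : LocalRing E v) := by
    have hre : Continuous (QuadraticCoordinates.re (quadraticLocalEquiv E v c hcδ hδ).toLinearEquiv.toAddEquiv) :=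
      QuadraticCoordinates.continuous_re _ (quadraticLocalEquiv E v c hcδ hδ).symm.continuous
    have hlc : IsLocallyConstant fun e : LocalRing E v => θ e := by
      simp only [hθa]
      exact (hψlc.comp_continuous hre).comp ((↑) : Circle → ℂ)
    refine (hlc.isOpen_fiber 1).mem_nhds ?_
    simp only [Set.mem_setOf_eq, hθa, map_zero, AddChar.map_zero_eq_one, Circle.coe_one]
  obtain ⟨n₁, hn₁⟩ := exists_forall_mem_primePowBall_subset hθ1
  have hC₀θ : ∀ e ∈ ball n₁, θ e = 1 := fun e he => hn₁ e ((hball n₁ e).1 he)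
  /- §6 separation data: `t₀` with `ψ_v(t₀) ≠ 1`, the open `U₀ ∋ 1`, the uniform bound `n₀`, the ball `C` -/
  obtain ⟨t₀, ht₀⟩ := AddChar.ne_zero_iff.1 (isContinuousNontrivial_adeleAddCharAt F v).2
  obtain ⟨U₀, hU₀⟩ : ∃ U₀ : Set (localPi E c 1 J₁ v),
      U₀ = (M.stabilizerSubgroup φ₀ : Set (localPi E c 1 J₁ v)) ∩ (χ.ker : Set (localPi E c 1 J₁ v)) := ⟨_, rfl⟩
  have hU₀o : IsOpen U₀ := by rw [hU₀]; exact (hMs φ₀).inter hχo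
  have hU₀1 : (1 : localPi E c 1 J₁ v) ∈ U₀ := by rw [hU₀]; exact ⟨(M.stabilizerSubgroup φ₀).one_mem, χ.ker.one_mem⟩
  obtain ⟨n₀, hn₀⟩ := exists_forall_sub_one_notMem_primePowBall c J₁ hc1 hJ₁ w hw hU₀o hU₀1
  obtain ⟨k₀, hk₀⟩ := exists_mem_primePowBall ((toLocalRing E v t₀) w)
  haveI : Finite (ball (k₀ - n₀) ⧸ (ball n₁).addSubgroupOf (ball (k₀ - n₀))) :=
    finite_quotient_addSubgroupOf_of_isCompact_of_isOpen (ball n₁) (ball (k₀ - n₀)) (hball_cpt _) (hball_open _)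
  /- §7 the free orbit: normalisation `M_z ρ_L(e) M_z⁻¹ = ρ_L(ζ_z e)` and separation off `U₀` -/
  have hZ : ∀ z : localPi E c 1 J₁ v, ∃ γ : LocalRing E v →+ LocalRing E v, (∀ e ∈ ball n₁, γ e ∈ ball n₁) ∧
      (∀ (e : LocalRing E v) (Φ : SchwartzBruhat (Fin N → v.adicCompletion F)), M z (ρL e Φ) = ρL (γ e) (M z Φ)) ∧
      ((M z φ₀ = φ₀ ∧ χ z = 1) ∨ ∃ e ∈ ball (k₀ - n₀), θ (γ e) ≠ θ e) := by
    intro z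
    obtain ⟨ζh, hζ⟩ := LemD1OfPlace.theta_surjective E v c N J hcδ hδ hN hJh hJdet J₁ hJ₁ z
    have hnorm : ∀ w' : PlacesOver E v,
        normAbs (w'.1.adicCompletion E) (((ζh : (LocalRing E v)ˣ) : LocalRing E v) w') = 1 := fun w' => by
      rw [← entry_theta E v c N hcδ hδ hN hJh hJdet J₁ ζh w', hζ]
      exact normAbs_entry_eq_one c J₁ hc1 hJ₁ w hw z w'
    refine ⟨AddMonoidHom.mulLeft ((ζh : (LocalRing E v)ˣ) : LocalRing E v), fun e he => ?_, fun e Φ => ?_, ?_⟩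
    · -- `ζ · C₀ ⊆ C₀` since `|ζ_{w'}| = 1`
      rw [hball] at he ⊢
      intro w'
      rw [AddMonoidHom.coe_mulLeft, Pi.mul_apply, mem_primePowBall_iff, map_mul, hnorm w', one_mul]
      exact he w'
    · -- `M z ρ_L(e) = ρ_L(ζ e) M z`: implementers transport `(w, ½B(w,w))` without scalar, and `ι(z) = reIm ∘ ζ ∘ reIm⁻¹`
      have himp := MpPsi.toRep_apply_mk_half (polar (localPairing F N T v)) (localSchrodinger F N T v)
        (s (localCenter E c N J J₁ hJ₁ v z)) (RI (e • x)) Φ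
      have hproj : (s (localCenter E c N J J₁ hJ₁ v z)).1.1.1 (RI (e • x)) =
          RI ((((ζh : (LocalRing E v)ˣ) : LocalRing E v) * e) • x) := by
        have h1 := hs (localCenter E c N J J₁ hJ₁ v z)
        rw [MpPsi.proj_apply] at h1
        rw [h1, ← hζ, hiota, mul_smul]
      rw [hproj] at himp
      rw [hρL, hρL, AddMonoidHom.coe_mulLeft]
      exact himp
    · -- separation
      by_cases hzU : z ∈ U₀
      · rw [hU₀] at hzU
        exact Or.inl ⟨(M.mem_stabilizerSubgroup φ₀ z).1 hzU.1, (MonoidHom.mem_ker).1 hzU.2⟩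
      · right
        have hζw : ((ζh : (LocalRing E v)ˣ) : LocalRing E v) w - 1 ∉ primePowBall (w.1.adicCompletion E) n₀ := by
          have h := hn₀ z hzU
          rwa [← hζ, entry_theta] at h
        have hζne : ((ζh : (LocalRing E v)ˣ) : LocalRing E v) - 1 ≠ 0 := by
          intro h0
          apply hζw
          have h0w : ((ζh : (LocalRing E v)ˣ) : LocalRing E v) w - 1 = 0 := by
            have := congrFun h0 w
            simpa only [Pi.sub_apply, Pi.one_apply, Pi.zero_apply] using this
          rw [h0w]; exact zero_mem_primePowBall n₀
        obtain ⟨y, hy⟩ := hE.mul_inv_cancel hζne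
        refine ⟨y * toLocalRing E v t₀, ?_, ?_⟩
        · -- `c = (ζ - 1)⁻¹ t₀ ∈ C`
          rw [hball]
          intro w'
          obtain rfl : w' = w := Subsingleton.elim _ _
          have hyw : (((ζh : (LocalRing E v)ˣ) : LocalRing E v) w' - 1) * y w' = 1 := by
            have := congrFun hy w'
            simpa only [Pi.mul_apply, Pi.sub_apply, Pi.one_apply] using this
          have hq0 : (0 : ℝ≥0) < (residueFieldCard (w'.1.adicCompletion E) : ℝ≥0)⁻¹ := inv_residueFieldCard_pos
          have hζgt : ((residueFieldCard (w'.1.adicCompletion E) : ℝ≥0)⁻¹) ^ n₀ <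
              normAbs (w'.1.adicCompletion E) (((ζh : (LocalRing E v)ˣ) : LocalRing E v) w' - 1) :=
            not_le.1 fun h => hζw h
          have hny : normAbs (w'.1.adicCompletion E) (((ζh : (LocalRing E v)ˣ) : LocalRing E v) w' - 1) *
              normAbs (w'.1.adicCompletion E) (y w') = 1 := by
            rw [← map_mul, hyw, map_one]
          have hyv : normAbs (w'.1.adicCompletion E) (y w') ≤
              ((residueFieldCard (w'.1.adicCompletion E) : ℝ≥0)⁻¹) ^ (-n₀) := by
            rw [eq_inv_of_mul_eq_one_right hny, zpow_neg]
            exact inv_anti₀ (zpow_pos hq0 _) hζgt.le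
          rw [Pi.mul_apply, mem_primePowBall_iff, map_mul]
          calc normAbs _ (y w') * normAbs _ (toLocalRing E v t₀ w')
              ≤ ((residueFieldCard (w'.1.adicCompletion E) : ℝ≥0)⁻¹) ^ (-n₀) *
                  ((residueFieldCard (w'.1.adicCompletion E) : ℝ≥0)⁻¹) ^ k₀ :=
                mul_le_mul' hyv (mem_primePowBall_iff.1 hk₀)
            _ = ((residueFieldCard (w'.1.adicCompletion E) : ℝ≥0)⁻¹) ^ (k₀ - n₀) := by
                rw [← zpow_add₀ hq0.ne', sub_eq_neg_add]
        · -- `θ(ζ c) / θ(c) = ψ_v(re((ζ - 1) c)) = ψ_v(t₀) ≠ 1`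
          intro heq
          apply ht₀
          rw [AddMonoidHom.coe_mulLeft, hθa, hθa] at heq
          have hinj := Subtype.val_injective heq
          have hdiff := AddChar.map_sub_eq_div (adeleAddCharAt F v)
            (QuadraticCoordinates.re (quadraticLocalEquiv E v c hcδ hδ).toLinearEquiv.toAddEquiv
              (((ζh : (LocalRing E v)ˣ) : LocalRing E v) * (y * toLocalRing E v t₀)))
            (QuadraticCoordinates.re (quadraticLocalEquiv E v c hcδ hδ).toLinearEquiv.toAddEquiv (y * toLocalRing E v t₀))
          rw [hinj, div_self', ← map_sub,
            show ((ζh : (LocalRing E v)ˣ) : LocalRing E v) * (y * toLocalRing E v t₀) - y * toLocalRing E v t₀ =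
              toLocalRing E v t₀ by
              rw [show ((ζh : (LocalRing E v)ˣ) : LocalRing E v) * (y * toLocalRing E v t₀) - y * toLocalRing E v t₀ =
                ((((ζh : (LocalRing E v)ˣ) : LocalRing E v) - 1) * y) * toLocalRing E v t₀ by ring, hy, one_mul],
            (isQuadraticCoordinates_local E v c hcδ hδ hd).re_map] at hdiff
          exact hdiff
  exact TwistedCoinv.nontrivial_coinv_of_free_orbit M χ hMs hχo ρL θ μℓ hμ hφ₀μ (ball n₁) (ball (k₀ - n₀)) hC₀θ hZ

end Literature.RepresentationTheory.MoeglinVignerasWaldspurger1987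

end
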